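import Summits.HodgeConjecture.CorCM.MultiFieldWeilDihedralDecicsGrouped
import HarnessLib

/-!
# MULTI-FIELD WEIL ENGINE — SHOWCASE: TWO `(2,3)`-FIVEFOLDS OVER ONE DIHEDRAL DECIC CM FIELD, WITH THE CM CURVE — the Hodge conjecture for every product of copies of
# `E`, `B₀`, `B₁`, given only Markman's hyperbolic-sixfold theorem

Cell `pub-hodgecm2` (COR-CM), seat b30 gen 42 (2026-08-26); count-neutral own lane MULTI-FIELD WEIL ENGINE (stem `MultiFieldWeil*`), the one-field reading (`J := PUnit`) of
`CorCM/MultiFieldWeilDihedralDecicsGrouped.lean`, written out for referees.  Theorems only; no definition, no named fact, no `sorry`.  HONEST FRAMING: conditional ONLY on the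
displayed Markman binder `hM6`; `HC_CM` is NOT proved and not asserted.

**`hodgeConjectureFor_biproduct_dihedralDecicPair`.**  DATA: `k` imaginary quadratic with its CM elliptic curve `E ⊨ (k; {τ})`; a DECIC CM field `K ⊇ iK(k)` whose Galois closure
in `ℂ` has degree `≤ 20` and with a `τ`-embedding `t₀` taking a value outside `ℚ(s₀(K))` for another `τ`-embedding `s₀` — equivalently `K = k·K⁺` with `K⁺` a real quintic field
whose Galois group is the DIHEDRAL group of order `10` (the five `τ`-embeddings of `K` are then permuted by `Aut(ℂ/k)` as the vertices of a pentagon by `D₅`: transitively but NOT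
`2`-transitively, so none of the `2`-transitive menus of this lane applies); two abelian fivefolds `B₀ ⊨ (K; Ψ₀)`, `B₁ ⊨ (K; Ψ₁)` with CM by `K`, each type having EXACTLY TWO
members over `τ` (`k`-signature `(2,3)`); FREENESS: every automorphism of `ℂ` over `τ(k)` that stabilises both `Ψ₀ ∩ {τ-embeddings}` and `Ψ₁ ∩ {τ-embeddings}` fixes every
`τ`-embedding of `K` — on the pentagon: the two `2`-sets `{a, b}`, `{a', b'}` of `τ`-members have DIFFERENT AXES (`a + b ≠ a' + b'` in `ℤ/5`), which holds e.g. whenever `Ψ₀` and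
`Ψ₁` SHARE a `τ`-embedding and differ.  CONCLUSION: the Hodge conjecture for `⨁_l X_l`, every `X_l ∈ {E, B₀, B₁}` — all `E^a × B₀^b × B₁^c` — and for every abelian variety
dominated by such a product, GIVEN ONLY Markman's theorem on Weil classes of hyperbolic sixfolds (`hM6`).  By `CorCM/MultiFieldWeilCommutantNoGo.lean` the freeness hypothesis
is SHARP for the method (common axis ⟹ a non-constant solution of the signed equations), and a third fivefold over `K` is never reached (`dim_{ℚ(√5)} V₀ = 2`).
[cite: Markman2025SecantWeil, Thm 1.5.1] [cite: Shimura1998, §6.1 Corollary of Theorem 2, §8.4, §18.2 Lemma (i)] [cite: DixonMortimer1996, §1.6, Thm. 1.6A; §2.1; §3.3]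
[cite: Serre1977, §5.3] [cite: Lang2002, VI §1 Thm. 1.1 and V §2 Thm. 2.8; XIII §4] [cite: MumfordAV1970, §19]

## References
* [Markman2025SecantWeil] E. Markman, Cycles on abelian 2n-folds of Weil type from secant sheaves on abelian n-folds, Thm 1.5.1.  [Shimura1998] G. Shimura, *Abelian varieties with
  complex multiplication and modular functions*, §6.1, §8.4, §18.2.  [DixonMortimer1996] J. D. Dixon, B. Mortimer, *Permutation Groups*, GTM 163.  [Serre1977] J.-P. Serre,
  *Linear Representations of Finite Groups*, GTM 42, §5.3.  [Lang2002] S. Lang, *Algebra*, GTM 211.  [MumfordAV1970] D. Mumford, *Abelian Varieties*, §19.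
-/

noncomputable section

open CategoryTheory CategoryTheory.Limits NumberField IntermediateField

namespace Summit.HodgeConjecture.CorCM.MultiFieldWeil

open Finset
open Literature.AlgebraicGeometry Literature.AlgebraicGeometry.Motives Literature.AlgebraicGeometry.HodgeTheory
open Literature.AlgebraicGeometry.ComplexMultiplication (IsCMTypeRealisation)
open Literature.AlgebraicTopology.SingularHomology
open Literature.NumberTheory.ComplexMultiplication

open scoped Classical

section Showcase

variable {K : Type} [fK : Field K] [nK : NumberField K] [cK : IsCMField K] {k : Type} [fk : Field k] [nk : NumberField k] [ck : IsCMField k] {τ : k →+* ℂ}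
  {B : Fin 2 → AbelianVariety ℂ} {Ψ : Fin 2 → CMType K} {ιB : ∀ t : Fin 2, 𝓞 K →+* End (B t)} {θB : ∀ t : Fin 2, K →+* Module.End ℂ (complexBetti (B t).X 1)}
  {E : AbelianVariety ℂ} {Φ₀ : CMType k} {ιE : 𝓞 k →+* End E} {θE : k →+* Module.End ℂ (complexBetti E.X 1)}

/-- **TWO `(2,3)`-FIVEFOLDS OVER ONE DIHEDRAL DECIC CM FIELD, WITH THE CM CURVE — GIVEN ONLY MARKMAN'S HYPERBOLIC-SIXFOLD THEOREM.**  See the module docstring.  `HC_CM` is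
NOT asserted. [cite: Markman2025SecantWeil, Thm 1.5.1] [cite: Shimura1998, §6.1 Corollary of Theorem 2, §8.4, §18.2] [cite: DixonMortimer1996, §1.6, Thm. 1.6A; §2.1; §3.3]
[cite: Serre1977, §5.3] [cite: Lang2002, VI §1 Thm. 1.1; XIII §4] -/
theorem hodgeConjectureFor_biproduct_dihedralDecicPair (hM6 : Markman2025_weilClasses_algebraic_hyperbolicSixfold) (h2 : Module.finrank ℚ k = 2) (iK : k →+* K)
    (h10 : Module.finrank ℚ K = 10) (hB : ∀ t, IsCMTypeRealisation (Ψ t) (B t) (ιB t) (θB t)) (hE : IsCMTypeRealisation Φ₀ E ιE θE)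
    (hΦ₀ : ∀ σ : k →+* ℂ, σ ∈ Φ₀.1 ↔ σ = τ) (hcnt : ∀ t, (Finset.univ.filter fun s : K →+* ℂ => s.comp iK = τ ∧ s ∈ (Ψ t).1).card = 2)
    (h20 : Module.finrank ℚ ↥(normalClosure ℚ K ℂ) ≤ 20) (hns : ∃ s₀ t₀ : K →+* ℂ, s₀.comp iK = τ ∧ t₀.comp iK = τ ∧ ∃ x, t₀ x ∉ adjoin ℚ (Set.range s₀))
    (hfree : ∀ ρ : ℂ ≃+* ℂ, (ρ : ℂ →+* ℂ).comp τ = τ → (∀ (t : Fin 2) (s : K →+* ℂ), s.comp iK = τ → (s ∈ (Ψ t).1 ↔ (ρ : ℂ →+* ℂ).comp s ∈ (Ψ t).1)) →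
      ∀ s : K →+* ℂ, s.comp iK = τ → (ρ : ℂ →+* ℂ).comp s = s)
    {N : ℕ} (κ : Fin N → Option (Fin 2)) :
    HodgeConjectureFor (⨁ fun l => ((κ l).elim E B : AbelianVariety ℂ)).dim (⨁ fun l => ((κ l).elim E B : AbelianVariety ℂ)).X := by
  have key := hodgeConjectureFor_biproduct_sigma_of_dihedralDecics (J := PUnit) (KJ := fun _ => K) (c := fun _ => 2) (B := fun _ t => B t) (Ψ := fun _ t => Ψ t)
    (ιB := fun _ t => ιB t) (θB := fun _ t => θB t) hM6 h2 (fun _ => iK) (fun _ => h10) (fun _ t => hB t) hE hΦ₀ (fun _ t => hcnt t) (fun _ => le_rfl)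
    (fun _ => h20) (fun _ => hns) (fun _ => hfree) (fun j j' hne => absurd (Subsingleton.elim j' j) hne)
    (fun l => (κ l).map fun t => (⟨PUnit.unit, t⟩ : (_ : PUnit) × Fin 2))
  have hfam : (fun l => (((κ l).map fun t => (⟨PUnit.unit, t⟩ : (_ : PUnit) × Fin 2)).elim E fun x => B x.2 : AbelianVariety ℂ)) = fun l => ((κ l).elim E B : AbelianVariety ℂ) := by
    funext l
    rcases κ l with _ | t <;> rfl
  rw [hfam] at key
  exact key

/-- **Dominated form**: every abelian variety dominated by a product of copies of `E`, `B₀`, `B₁` (e.g. isogenous to one). [cite: Markman2025SecantWeil, Thm 1.5.1]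
[cite: MumfordAV1970, §19] -/
theorem hodgeConjectureFor_of_avDominatedBy_dihedralDecicPair (hM6 : Markman2025_weilClasses_algebraic_hyperbolicSixfold) (h2 : Module.finrank ℚ k = 2) (iK : k →+* K)
    (h10 : Module.finrank ℚ K = 10) (hB : ∀ t, IsCMTypeRealisation (Ψ t) (B t) (ιB t) (θB t)) (hE : IsCMTypeRealisation Φ₀ E ιE θE)
    (hΦ₀ : ∀ σ : k →+* ℂ, σ ∈ Φ₀.1 ↔ σ = τ) (hcnt : ∀ t, (Finset.univ.filter fun s : K →+* ℂ => s.comp iK = τ ∧ s ∈ (Ψ t).1).card = 2)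
    (h20 : Module.finrank ℚ ↥(normalClosure ℚ K ℂ) ≤ 20) (hns : ∃ s₀ t₀ : K →+* ℂ, s₀.comp iK = τ ∧ t₀.comp iK = τ ∧ ∃ x, t₀ x ∉ adjoin ℚ (Set.range s₀))
    (hfree : ∀ ρ : ℂ ≃+* ℂ, (ρ : ℂ →+* ℂ).comp τ = τ → (∀ (t : Fin 2) (s : K →+* ℂ), s.comp iK = τ → (s ∈ (Ψ t).1 ↔ (ρ : ℂ →+* ℂ).comp s ∈ (Ψ t).1)) →
      ∀ s : K →+* ℂ, s.comp iK = τ → (ρ : ℂ →+* ℂ).comp s = s)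
    {N : ℕ} (κ : Fin N → Option (Fin 2)) {X : AbelianVariety ℂ} (hX : Domination.AVDominatedBy X (⨁ fun l => ((κ l).elim E B : AbelianVariety ℂ))) :
    HodgeConjectureFor X.dim X.X :=
  Domination.hodgeConjectureFor_of_avDominatedBy (hodgeConjectureFor_biproduct_dihedralDecicPair hM6 h2 iK h10 hB hE hΦ₀ hcnt h20 hns hfree κ) hX

end Showcase

end Summit.HodgeConjecture.CorCM.MultiFieldWeil

end
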